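import Mathlib.CategoryTheory.Comma.Over.Basic
import Literature.AlgebraicGeometry.Frobenioids.GroupLikeStandardExample
import Literature.AlgebraicGeometry.Frobenioids.RationalSemidirectBase
import HarnessLib

/-!
# Frobenioids I, §3: Example 3.8 (permutation of primes)

Mochizuki, *The geometry of Frobenioids I: the general theory*, Kyushu J. Math. **62** (2008)
293–400, kurims text p. 71 [cite: MochizukiFrdI2008, Ex. 3.8 p.71].  Data: `α : N_{≥1} ⥲ N_{≥1}` of
order (dividing) `2` together with its extension to `N = (N_{≥1})^gp` (`Datum`), `U = V = W = ℚ`,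
`G = U ⋊ N` and `D` (file `RationalSemidirectBase.lean`), the monoid `Φ` on `D` with
`g ↦ (α(n), α(n) · n⁻¹)` (DEFINED as a genuine functor `Dᵒᵖ ⥤ CommMonCat`), `C := F_Φ` (found's
`ElemFrobenioid`).

PROVED: "`D` is manifestly of FSM-, hence also of FSMFF-type"; the printed monoid `M` on
`U × V × W × N × N_{≥1}` is a monoid; "the assignment `(u, v, w, n, m) ↦ (v, u, w, α(n)⁻¹ m⁻¹, α(m))`
determines an automorphism of the monoid `M`" (homomorphism + involution — the "routine
verification" uses `α ∘ α = id`); it "clearly preserves base-isomorphisms" (every base component lies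
in the group `G`), "but fails to preserve `O^×(−)` [i.e., the subspace `{0} × V × W`] or Frobenius
degrees [when `α` is not the identity]" (witnesses).
COMPUTED (Def. 1.1 (iii)) and RECORDED: under the evident bijection `End_C ≃ M` the `U, N, N_{≥1}`
coordinates multiply as printed, while the `V, W`-coordinates of a product are
`α(n_ψ)·v_φ + m_φ·v_ψ`, `α(n_ψ) n_ψ⁻¹·w_φ + m_φ·w_ψ` — the printed law attaches the twist
`α(n₁)`, `α(n₁) n₁⁻¹` to the other factor (the two agree in pushed-forward coordinates exactly when
`Φ(g)` is read as the inverse of the displayed automorphism); the printed identification `EndLawAsPrinted` is typed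
FALSE-AS-TYPED and REFUTED in-file (`not_endLawAsPrinted`, RULING P1).  Named: "`Aut(D_A → D) ≅ G`".
Deliberately NOT here (predicates of seats found/t3 not yet landed): "`C` is a Frobenioid of
Frobenius-normalized, isotropic and group-like type", "Frobenius-compact", "of standard type",
"`D` fails to be Frobenius-slim" (the injection `𝔽 ↪ G` it rests on is proved in
`RationalSemidirectBase.lean`).  No statement of the paper is strengthened.
-/

namespace Literature.AlgebraicGeometry.Frobenioids

open CategoryTheory

/-! ### Example 3.8: permutation of primes -/

namespace Ex38

open RatSemidirect

/-- The datum of Ex. 3.8: "`α : N_{≥1} ⥲ N_{≥1}` an automorphism of monoids of order `2` [so `α` acts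
on `N = (N_{≥1})^gp`]" (FrdI p. 71) — recorded as the automorphism `α` of `N_{≥1}`, its extension
`αN` to `N` (along `natPos`), and the involution property of the extension (from which `α ∘ α = id`
follows). ("Order 2" would also exclude `α = id`; the text itself later says "[when `α` is not equal
to the identity]", so only the involution property is recorded.) [cite: MochizukiFrdI2008, Ex. 3.8 p.71] -/
structure Datum : Type where
  /-- the automorphism of the monoid `N_{≥1}` -/
  α : ℕ+ ≃* ℕ+
  /-- its extension to `N = (N_{≥1})^gp` -/
  αN : N ≃* N
  /-- compatibility with `N_{≥1} ↪ N` -/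
  compat : ∀ m, αN (natPos m) = natPos (α m)
  /-- `αN` has order dividing `2` -/
  invol : ∀ n, αN (αN n) = n

variable (P : Datum)

/-- `α ∘ α = id` on `N_{≥1}`. [cite: MochizukiFrdI2008, Ex. 3.8 p.71] -/
theorem Datum.α_α (m : ℕ+) : P.α (P.α m) = m := by
  apply natPos_injective
  rw [← P.compat, ← P.compat, P.invol]

/-- The scalar by which `g ∈ G` (with `N`-part `n`) acts on `V`: `α(n)` (p. 71). [cite: MochizukiFrdI2008, Ex. 3.8 p.71] -/
def Datum.cV (n : N) : ℚ := (P.αN n : ℚ)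

/-- The scalar by which `g` acts on `W`: `α(n) · n⁻¹` (p. 71). [cite: MochizukiFrdI2008, Ex. 3.8 p.71] -/
def Datum.cW (n : N) : ℚ := (P.αN n : ℚ) * (n : ℚ)⁻¹

/-- `cV` is multiplicative. [cite: MochizukiFrdI2008, Ex. 3.8 p.71] -/
theorem Datum.cV_mul (n n' : N) : P.cV (n * n') = P.cV n * P.cV n' := by
  simp [Datum.cV, Positive.val_mul]

/-- `cW` is multiplicative. [cite: MochizukiFrdI2008, Ex. 3.8 p.71] -/
theorem Datum.cW_mul (n n' : N) : P.cW (n * n') = P.cW n * P.cW n' := by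
  simp only [Datum.cW, map_mul, Positive.val_mul, mul_inv]
  ring

/-- `cV 1 = 1`. [cite: MochizukiFrdI2008, Ex. 3.8 p.71] -/
@[simp] theorem Datum.cV_one : P.cV 1 = 1 := by simp [Datum.cV, Positive.val_one]

/-- `cW 1 = 1`. [cite: MochizukiFrdI2008, Ex. 3.8 p.71] -/
@[simp] theorem Datum.cW_one : P.cW 1 = 1 := by simp [Datum.cW, Positive.val_one]

/-- The action of Ex. 3.8: `g ∈ G` projecting to `n ∈ N` acts on `V × W = ℚ × ℚ` by "the automorphism
… given by `(α(n), α(n) · n⁻¹)`" (FrdI p. 71; written multiplicatively). [cite: MochizukiFrdI2008, Ex. 3.8 p.71] -/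
def Datum.act (g : G) : Multiplicative (ℚ × ℚ) →* Multiplicative (ℚ × ℚ) :=
  AddMonoidHom.toMultiplicative
    { toFun := fun z => (P.cV g.n * z.1, P.cW g.n * z.2)
      map_zero' := by simp
      map_add' := fun z z' => by ext <;> simp [mul_add] }

/-- Values of the action. [cite: MochizukiFrdI2008, Ex. 3.8 p.71] -/
@[simp] theorem Datum.toAdd_act (g : G) (z : Multiplicative (ℚ × ℚ)) :
    Multiplicative.toAdd (P.act g z) =
      (P.cV g.n * (Multiplicative.toAdd z).1, P.cW g.n * (Multiplicative.toAdd z).2) :=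
  rfl

/-- The action is compatible with the product of `G` (it factors through the abelian group `N`).
[cite: MochizukiFrdI2008, Ex. 3.8 p.71] -/
theorem Datum.act_mul (g g' : G) : P.act (g * g') = (P.act g').comp (P.act g) := by
  refine MonoidHom.ext fun z => Multiplicative.toAdd.injective ?_
  simp only [Datum.toAdd_act, MonoidHom.coe_comp, Function.comp_apply, G.mul_n, Datum.cV_mul,
    Datum.cW_mul, Prod.mk.injEq]
  exact ⟨by ring, by ring⟩

/-- `act 1 = id`. [cite: MochizukiFrdI2008, Ex. 3.8 p.71] -/
theorem Datum.act_one : P.act 1 = MonoidHom.id _ := by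
  refine MonoidHom.ext fun z => Multiplicative.toAdd.injective ?_
  simp [Datum.toAdd_act]

/-- `Φ`: "the monoid on `D` that associates to the unique object of `D` the monoid `V × W` and to a
morphism `g ∈ G` that projects to `n ∈ N` the automorphism of `V × W` given by `(α(n), α(n) · n⁻¹)`"
(FrdI p. 71), as a functor `Dᵒᵖ ⥤ CommMonCat`. [cite: MochizukiFrdI2008, Ex. 3.8 p.71] -/
def Φ : Dᵒᵖ ⥤ CommMonCat.{0} where
  obj _ := CommMonCat.of (Multiplicative (ℚ × ℚ))
  map f := CommMonCat.ofHom (P.act (show G from f.unop))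
  map_id A := by
    ext x : 2
    change P.act 1 x = x
    rw [Datum.act_one]; rfl
  map_comp f g := by
    ext x : 2
    change P.act ((show G from f.unop) * (show G from g.unop)) x = P.act _ (P.act _ x)
    rw [Datum.act_mul]; rfl

/-- `C := F_Φ` (FrdI p. 71), found's elementary Frobenioid; its unique object.
[cite: MochizukiFrdI2008, Ex. 3.8 p.71] -/
abbrev obj : ElemFrobenioid (Φ P) := ElemFrobenioid.of (Φ P) (SingleObj.star G)

/-- "the category `D` is manifestly of FSM-, hence also of FSMFF-type" (FrdI p. 71; PROVED — the same
`D` as in Ex. 3.9). [cite: MochizukiFrdI2008, Ex. 3.8 p.71] -/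
theorem isOfFSMFFType_D : IsOfFSMFFType D :=
  (⟨fun f _ => (SingleObj.isIso_iff_isUnit f).mpr (Group.isUnit _)⟩ : IsOfFSMType D).isOfFSMFFType

/-- The printed monoid `M` of Ex. 3.8: underlying set `U × V × W × N × N_{≥1}` (FrdI p. 71).  (The type
carries the datum `P` because the printed law involves `α`.) [cite: MochizukiFrdI2008, Ex. 3.8 p.71] -/
@[ext] structure M (P : Datum) : Type where
  /-- `u ∈ U = ℚ` -/
  u : ℚ
  /-- `v ∈ V = ℚ` -/
  v : ℚ
  /-- `w ∈ W = ℚ` -/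
  w : ℚ
  /-- `n ∈ N` -/
  n : N
  /-- `m ∈ N_{≥1}` -/
  m : ℕ+

namespace M

/-- The printed law `(u₁,v₁,w₁,n₁,m₁) · (u₂,v₂,w₂,n₂,m₂) = (u₁ + n₁⁻¹ u₂, v₁ + m₁ α(n₁) v₂,
w₁ + m₁ α(n₁) n₁⁻¹ w₂, n₁ n₂, m₁ m₂)` (FrdI p. 71) is a monoid structure (PROVED).
[cite: MochizukiFrdI2008, Ex. 3.8 p.71] -/
instance instMonoid : Monoid (M P) where
  mul x y := ⟨x.u + (x.n : ℚ)⁻¹ * y.u, x.v + (x.m : ℚ) * P.cV x.n * y.v, x.w + (x.m : ℚ) * P.cW x.n * y.w,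
    x.n * y.n, x.m * y.m⟩
  one := ⟨0, 0, 0, 1, 1⟩
  mul_assoc x y z := by
    refine M.ext ?_ ?_ ?_ (mul_assoc _ _ _) (mul_assoc _ _ _)
    · show x.u + (x.n : ℚ)⁻¹ * y.u + ((x.n * y.n : N) : ℚ)⁻¹ * z.u =
        x.u + (x.n : ℚ)⁻¹ * (y.u + (y.n : ℚ)⁻¹ * z.u)
      rw [Positive.val_mul, mul_inv]; ring
    · show x.v + (x.m : ℚ) * P.cV x.n * y.v + ((x.m * y.m : ℕ+) : ℚ) * P.cV (x.n * y.n) * z.v =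
        x.v + (x.m : ℚ) * P.cV x.n * (y.v + (y.m : ℚ) * P.cV y.n * z.v)
      rw [Datum.cV_mul, PNat.mul_coe, Nat.cast_mul]; ring
    · show x.w + (x.m : ℚ) * P.cW x.n * y.w + ((x.m * y.m : ℕ+) : ℚ) * P.cW (x.n * y.n) * z.w =
        x.w + (x.m : ℚ) * P.cW x.n * (y.w + (y.m : ℚ) * P.cW y.n * z.w)
      rw [Datum.cW_mul, PNat.mul_coe, Nat.cast_mul]; ring
  one_mul x := by
    refine M.ext ?_ ?_ ?_ (one_mul _) (one_mul _)
    · show 0 + ((1 : N) : ℚ)⁻¹ * x.u = x.u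
      simp [Positive.val_one]
    · show 0 + ((1 : ℕ+) : ℚ) * P.cV 1 * x.v = x.v
      simp
    · show 0 + ((1 : ℕ+) : ℚ) * P.cW 1 * x.w = x.w
      simp
  mul_one x := by
    refine M.ext ?_ ?_ ?_ (mul_one _) (mul_one _)
    · show x.u + (x.n : ℚ)⁻¹ * 0 = x.u
      simp
    · show x.v + (x.m : ℚ) * P.cV x.n * 0 = x.v
      simp
    · show x.w + (x.m : ℚ) * P.cW x.n * 0 = x.w
      simp

variable {P}

/-- Components of the product. [cite: MochizukiFrdI2008, Ex. 3.8 p.71] -/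
@[simp] theorem mul_u (x y : M P) : (x * y).u = x.u + (x.n : ℚ)⁻¹ * y.u := rfl
/-- Components of the product. [cite: MochizukiFrdI2008, Ex. 3.8 p.71] -/
@[simp] theorem mul_v (x y : M P) : (x * y).v = x.v + (x.m : ℚ) * P.cV x.n * y.v := rfl
/-- Components of the product. [cite: MochizukiFrdI2008, Ex. 3.8 p.71] -/
@[simp] theorem mul_w (x y : M P) : (x * y).w = x.w + (x.m : ℚ) * P.cW x.n * y.w := rfl
/-- Components of the product. [cite: MochizukiFrdI2008, Ex. 3.8 p.71] -/
@[simp] theorem mul_n (x y : M P) : (x * y).n = x.n * y.n := rfl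
/-- Components of the product. [cite: MochizukiFrdI2008, Ex. 3.8 p.71] -/
@[simp] theorem mul_m (x y : M P) : (x * y).m = x.m * y.m := rfl
/-- The unit. [cite: MochizukiFrdI2008, Ex. 3.8 p.71] -/
@[simp] theorem one_n : (1 : M P).n = 1 := rfl
/-- The unit. [cite: MochizukiFrdI2008, Ex. 3.8 p.71] -/
@[simp] theorem one_m : (1 : M P).m = 1 := rfl

end M

/-- The evident bijection of SETS `End_C ≃ M`: `(Base = (u, n), Div = (v, w), deg_Fr = m) ↦
(u, v, w, n, m)` (FrdI p. 71). [cite: MochizukiFrdI2008, Ex. 3.8 p.71] -/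
def endEquivSet : End (obj P) ≃ M P where
  toFun φ := ⟨(ElemFrobenioid.Base φ).u, (Multiplicative.toAdd (ElemFrobenioid.Div φ)).1,
    (Multiplicative.toAdd (ElemFrobenioid.Div φ)).2, (ElemFrobenioid.Base φ).n, ElemFrobenioid.degFr φ⟩
  invFun x := ElemFrobenioid.homMk (⟨x.u, x.n⟩ : G) (Multiplicative.ofAdd (x.v, x.w)) x.m
  left_inv _ := rfl
  right_inv _ := rfl

/-- The `U`, `N`, `N_{≥1}`-coordinates of `endEquivSet` multiply as printed (PROVED from Def. 1.1
(iii)). [cite: MochizukiFrdI2008, Ex. 3.8 p.71] -/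
theorem endEquivSet_mul_unm (φ ψ : End (obj P)) :
    (endEquivSet P (φ * ψ)).u = (endEquivSet P φ * endEquivSet P ψ).u ∧
    (endEquivSet P (φ * ψ)).n = (endEquivSet P φ * endEquivSet P ψ).n ∧
    (endEquivSet P (φ * ψ)).m = (endEquivSet P φ * endEquivSet P ψ).m :=
  ⟨rfl, rfl, mul_comm _ _⟩

/-- The `V`- and `W`-coordinates of a product in `End_C` COMPUTED from Def. 1.1 (iii) (`Div(φ ∘ ψ) =
ψ_D^*(Div φ) + deg_Fr(φ) · Div(ψ)`): `v(φ·ψ) = α(n_ψ) · v_φ + m_φ · v_ψ`,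
`w(φ·ψ) = α(n_ψ) n_ψ⁻¹ · w_φ + m_φ · w_ψ` (PROVED).  CAVEAT (recorded for the referee): the printed
law has `v₁ + m₁ α(n₁) v₂`, `w₁ + m₁ α(n₁) n₁⁻¹ w₂` — the twist by the LEFT factor; the two agree in
the coordinates `(v, w) ↦ Φ(Base)·(v, w)`-pushforward exactly when `Φ(g)` is read as the INVERSE of
the displayed automorphism (covariant convention); under the literal reading they differ.  No repair
attempted. [cite: MochizukiFrdI2008, Ex. 3.8 p.71] -/
theorem endEquivSet_mul_vw (φ ψ : End (obj P)) :
    (endEquivSet P (φ * ψ)).v =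
      P.cV (endEquivSet P ψ).n * (endEquivSet P φ).v + ((endEquivSet P φ).m : ℚ) * (endEquivSet P ψ).v ∧
    (endEquivSet P (φ * ψ)).w =
      P.cW (endEquivSet P ψ).n * (endEquivSet P φ).w + ((endEquivSet P φ).m : ℚ) * (endEquivSet P ψ).w := by
  constructor
  · show (Multiplicative.toAdd (P.act (ElemFrobenioid.Base ψ) (ElemFrobenioid.Div φ) *
        (show Multiplicative (ℚ × ℚ) from ElemFrobenioid.Div ψ) ^ (ElemFrobenioid.degFr φ : ℕ))).1 = _
    simp only [toAdd_mul, toAdd_pow, Datum.toAdd_act, Prod.fst_add, nsmul_eq_mul]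
    rfl
  · show (Multiplicative.toAdd (P.act (ElemFrobenioid.Base ψ) (ElemFrobenioid.Div φ) *
        (show Multiplicative (ℚ × ℚ) from ElemFrobenioid.Div ψ) ^ (ElemFrobenioid.degFr φ : ℕ))).2 = _
    simp only [toAdd_mul, toAdd_pow, Datum.toAdd_act, Prod.snd_add, nsmul_eq_mul]
    rfl

/-- FALSE AS TYPED (erratum candidate E1 / printed-claim-under-review; RULING P1): FrdI Ex. 3.8, the
evident bijection `End_C ≃ M` is multiplicative for the PRINTED law of `M`.  The `U, N, N_{≥1}` parts hold
(`endEquivSet_mul_unm`); the `V, W`-parts do not under the literal reading of `Φ(g)`: the computed law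
is `endEquivSet_mul_vw` (REPAIRED statement, PROVED) and `not_endLawAsPrinted` refutes the printed one
for EVERY datum (witness `n_ψ = 2`, `v_φ = 1`, `v_ψ = 0`: `α(2) ≠ 1`).  Convention note: reading `Φ(g)`
as the INVERSE of the displayed automorphism together with the push-forward coordinates
`(v, w) ↦ (α(n) v, α(n) n⁻¹ w)` recovers the printed law, so this discrepancy is convention-level
(unlike Ex. 3.7).  Consumers must NOT bind `(h : EndLawAsPrinted P)`. [cite: MochizukiFrdI2008, Ex. 3.8 p.71] -/
def EndLawAsPrinted : Prop :=
  ∀ φ ψ : End (obj P), endEquivSet P (φ * ψ) = endEquivSet P φ * endEquivSet P ψ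

/-- Kernel-checked refutation of `EndLawAsPrinted` for every datum (RULING P1; erratum candidate E1,
convention-level, recorded neutrally). [cite: MochizukiFrdI2008, Ex. 3.8 p.71] -/
theorem not_endLawAsPrinted : ¬ EndLawAsPrinted P := by
  intro h
  let φ : End (obj P) := (endEquivSet P).symm ⟨0, 1, 0, 1, 1⟩
  let ψ : End (obj P) := (endEquivSet P).symm ⟨0, 0, 0, natPos 2, 1⟩
  have h1 := congrArg M.v (h φ ψ)
  rw [(endEquivSet_mul_vw P φ ψ).1] at h1
  simp only [φ, ψ, Equiv.apply_symm_apply, M.mul_v, PNat.one_coe, Nat.cast_one, Datum.cV_one,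
    mul_zero, mul_one, add_zero] at h1
  -- `h1 : P.cV (natPos 2) = 1`
  have h2 : P.αN (natPos 2) = 1 := Subtype.ext (by simpa [Datum.cV] using h1)
  have h3 : natPos 2 = 1 := (MulEquiv.map_eq_one_iff P.αN).mp h2
  exact absurd (congrArg Subtype.val h3) (by norm_num [natPos])

/-- "a routine verification reveals that the assignment `(u, v, w, n, m) ↦ (v, u, w, α(n)⁻¹·m⁻¹, α(m))`
determines an automorphism of the monoid `M`" (FrdI p. 71; PROVED for the printed law: a monoid
homomorphism and an involution). [cite: MochizukiFrdI2008, Ex. 3.8 p.71] -/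
def θ : M P →* M P where
  toFun x := ⟨x.v, x.u, x.w, (P.αN x.n)⁻¹ * (natPos x.m)⁻¹, P.α x.m⟩
  map_one' := M.ext rfl rfl rfl (by simp) (by simp)
  map_mul' x y := by
    have hαm : (P.αN ((P.αN x.n)⁻¹ * (natPos x.m)⁻¹) : ℚ) = (x.n : ℚ)⁻¹ * ((P.α x.m : ℕ) : ℚ)⁻¹ := by
      rw [map_mul, map_inv, map_inv, P.invol, P.compat, Positive.val_mul, Positive.coe_inv,
        Positive.coe_inv, natPos_val]
    have hm : ((P.α x.m : ℕ) : ℚ) ≠ 0 := by exact_mod_cast (P.α x.m).ne_zero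
    have hn : (x.n : ℚ) ≠ 0 := x.n.2.ne'
    have hαn : ((P.αN x.n : N) : ℚ) ≠ 0 := (P.αN x.n).2.ne'
    have hxm : ((x.m : ℕ) : ℚ) ≠ 0 := by exact_mod_cast x.m.ne_zero
    refine M.ext ?_ ?_ ?_ ?_ (map_mul _ _ _)
    · show (x * y).v = x.v + (((P.αN x.n)⁻¹ * (natPos x.m)⁻¹ : N) : ℚ)⁻¹ * y.v
      rw [M.mul_v, Positive.val_mul, Positive.coe_inv, Positive.coe_inv, natPos_val, Datum.cV]
      rw [mul_inv, inv_inv, inv_inv, mul_comm ((P.αN x.n : N) : ℚ)]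
    · show (x * y).u = x.u + ((P.α x.m : ℕ) : ℚ) * P.cV ((P.αN x.n)⁻¹ * (natPos x.m)⁻¹) * y.u
      rw [M.mul_u, Datum.cV, hαm]
      field_simp
    · show (x * y).w = x.w + ((P.α x.m : ℕ) : ℚ) * P.cW ((P.αN x.n)⁻¹ * (natPos x.m)⁻¹) * y.w
      simp only [M.mul_w, Datum.cW]
      rw [hαm, Positive.val_mul, Positive.coe_inv, Positive.coe_inv, natPos_val]
      field_simp
    · show (P.αN (x * y).n)⁻¹ * (natPos (x * y).m)⁻¹ =
        (P.αN x.n)⁻¹ * (natPos x.m)⁻¹ * ((P.αN y.n)⁻¹ * (natPos y.m)⁻¹)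
      rw [M.mul_n, M.mul_m, map_mul, map_mul, mul_inv, mul_inv, mul_mul_mul_comm]

/-- `θ` is an involution (so it is bijective: an automorphism of `M`). [cite: MochizukiFrdI2008, Ex. 3.8 p.71] -/
theorem θ_θ (x : M P) : θ P (θ P x) = x := by
  refine M.ext rfl rfl rfl ?_ (P.α_α x.m)
  show (P.αN ((P.αN x.n)⁻¹ * (natPos x.m)⁻¹))⁻¹ * (natPos (P.α x.m))⁻¹ = x.n
  rw [map_mul, map_inv, map_inv, P.invol, P.compat, mul_inv, inv_inv, inv_inv, mul_assoc,
    mul_inv_cancel, mul_one]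

/-- The automorphism `θ` as a `MulEquiv`. [cite: MochizukiFrdI2008, Ex. 3.8 p.71] -/
def θEquiv : M P ≃* M P :=
  { θ P with invFun := θ P, left_inv := θ_θ P, right_inv := θ_θ P }

/-- "… a self-equivalence of `C`, which clearly preserves base-isomorphisms" (FrdI p. 71): every arrow
of `D` is an isomorphism (`G` is a group), so every arrow of `C` is a base-isomorphism and there is
nothing to check — recorded as: the base component `(u, n) ∈ G` of every element of `M` is a unit.
[cite: MochizukiFrdI2008, Ex. 3.8 p.71] -/
theorem base_isUnit (x : M P) : IsUnit (⟨x.u, x.n⟩ : G) := Group.isUnit _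

/-- "… but fails to preserve `O^×(−)` [i.e., the subspace `{0} × V × W ⊆ U × V × W]" (FrdI p. 71;
PROVED at the level of `M`: `(0, 1, 0, 1, 1) ↦ (1, 0, 0, …)`). [cite: MochizukiFrdI2008, Ex. 3.8 p.71] -/
theorem θ_not_preserves_units : ∃ x : M P, x.u = 0 ∧ (θ P x).u ≠ 0 :=
  ⟨⟨0, 1, 0, 1, 1⟩, rfl, one_ne_zero⟩

/-- "… or Frobenius degrees [when `α` is not equal to the identity]" (FrdI p. 71; PROVED: the
Frobenius degree `m` is sent to `α(m)`). [cite: MochizukiFrdI2008, Ex. 3.8 p.71] -/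
theorem θ_not_preserves_degFr (h : ∃ m, P.α m ≠ m) : ∃ x : M P, (θ P x).m ≠ x.m := by
  obtain ⟨m, hm⟩ := h
  exact ⟨⟨0, 0, 0, 1, m⟩, hm⟩

/-- "if `A ∈ Ob(D)`, then `Aut(D_A → D) ≅ G`" (FrdI p. 71) — named statement.
[cite: MochizukiFrdI2008, Ex. 3.8 p.71] -/
def AutForgetIsoG : Prop := Nonempty (Aut (Over.forget (SingleObj.star G)) ≃* G)

end Ex38

end Literature.AlgebraicGeometry.Frobenioids
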